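import Summits.ValiantsHypothesis.ValiantsHypothesis.Theorems.PolyaContinuedMonotoneCoverHardLabelLevelled
import Summits.ValiantsHypothesis.ValiantsHypothesis.Theorems.PolyaContinuedMonotoneCoverHardWidthBet

/-!
# Crux `MonotoneCoverHard` (stmt-ValiantsHypothesis-7421), line `width_cut` — the crux is REDUCED IN
KERNEL TO LEVEL-MIXING COVERS: `MixingWidthBet → WidthBet → MonotoneCoverHard`

(val-width-7421-p4 g0, 2026-08-28.)

The registered stub `stub_width` of line `width_cut` is the WIDTH BET (`…WidthBet.lean`,
`monotoneCoverHard_of_widthBet`): every label-bijective Pfaffian cover of `per_n`, `n ≥ n₀`, with a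
level function `g` on its used edges has a balanced level `h ≥ 1` with widths
`c_h + c_{h−1} ≤ (log₂ m + d)^d`.  By `…LabelLevelled.lean` / `…RowLevelled.lean` a cover that is
LABEL-LEVELLED on its used edges (no variable `x_{kl}` is read at two different row levels by two
weight-nonzero perfect matchings) has ALL widths `≤ 2`, hence satisfies the bet's conclusion outright
(balanced level by `exists_balanced_level`, widths transferred by `varCount_eq` / `belowCount_eq` on the
used-edge sub-cover).  So the bet need only be assumed for LEVEL-MIXING covers:

* `widthBet_of_mixingWidthBet` — the width bet restricted to covers with two weight-nonzero perfect
  matchings reading the same variable at different row levels implies the full width bet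
  (`d ↦ d + 2`, `n₀ ↦ n₀ + 7`);
* `monotoneCoverHard_of_mixingWidthBet` — hence implies the crux `MonotoneCoverHard` BY NAME.

A planner may re-register line `width_cut` with the sharper single stub (the hypothesis of
`monotoneCoverHard_of_mixingWidthBet`, verbatim).  VP ≠ VNP is not moved; `MonotoneCoverHard` stays
open (now: open exactly for level-mixing Pfaffian covers).  No definitions.
-/

namespace Summit.ValiantsHypothesis.ValiantsHypothesis.Theorems.PolyaContinuedMonotoneCoverHard

-- summit = sub-problem name (single-conjunct summit, D-0017 layout), so the namespace repeats it
set_option linter.dupNamespace false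

open scoped Classical
open Finset
open Literature.Computability.AlgebraicComplexity (perPoly)
open Summit.ValiantsHypothesis.ValiantsHypothesis.Theses.PolyaContinued (MonotoneCoverHard)

/-- **Mixing width bet ⇒ width bet.**  If the width bet holds for all LEVEL-MIXING label-bijective
Pfaffian covers (some variable read at two different row levels by two weight-nonzero perfect
matchings), then it holds for all label-bijective Pfaffian covers. -/
theorem widthBet_of_mixingWidthBet
    (hmix : ∃ d n₀ : ℕ, ∀ (n m : ℕ) (E : Finset (Fin m × Fin m))
      (a : Fin m × Fin m → MvPolynomial (Fin n × Fin n) ℂ), n₀ ≤ n →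
      (∃ s : Fin m × Fin m → ℂ, (∀ e, s e = 1 ∨ s e = -1) ∧
        (Matrix.of fun i j => if (i, j) ∈ E then MvPolynomial.C (s (i, j)) * MvPolynomial.X (i, j)
            else 0 : Matrix (Fin m) (Fin m) (MvPolynomial (Fin m × Fin m) ℂ)).det =
          (Matrix.of fun i j => if (i, j) ∈ E then MvPolynomial.X (i, j) else 0 :
            Matrix (Fin m) (Fin m) (MvPolynomial (Fin m × Fin m) ℂ)).permanent) →
      (∀ e, (∃ j, a e = MvPolynomial.X j) ∨ a e = 0 ∨ a e = 1) →
      perPoly (Fin n) ℂ =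
        MvPolynomial.aeval a (Matrix.of fun i j => if (i, j) ∈ E then MvPolynomial.X (i, j) else 0 :
            Matrix (Fin m) (Fin m) (MvPolynomial (Fin m × Fin m) ℂ)).permanent →
      ∀ g : Fin m ⊕ Fin m → ℕ,
        (∀ τ : Equiv.Perm (Fin m), (∀ i, (i, τ i) ∈ E ∧ a (i, τ i) ≠ 0) → ∀ i,
          (∃ k, a (i, τ i) = MvPolynomial.X k) → g (Sum.inr (τ i)) = g (Sum.inl i) + 1) →
        (∀ τ : Equiv.Perm (Fin m), (∀ i, (i, τ i) ∈ E ∧ a (i, τ i) ≠ 0) → ∀ i,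
          (¬ ∃ k, a (i, τ i) = MvPolynomial.X k) → g (Sum.inr (τ i)) = g (Sum.inl i)) →
        (∃ τ τ' : Equiv.Perm (Fin m), (∀ i, (i, τ i) ∈ E ∧ a (i, τ i) ≠ 0) ∧
          (∀ i, (i, τ' i) ∈ E ∧ a (i, τ' i) ≠ 0) ∧ ∃ (i i' : Fin m) (v : Fin n × Fin n),
            a (i, τ i) = MvPolynomial.X v ∧ a (i', τ' i') = MvPolynomial.X v ∧
            g (Sum.inl i) ≠ g (Sum.inl i')) →
        ∃ h ch cq : ℕ, 1 ≤ h ∧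
          (∀ τ : Equiv.Perm (Fin m), (∀ i, (i, τ i) ∈ E ∧ a (i, τ i) ≠ 0) →
            n ≤ 3 * (Finset.univ.filter fun i : Fin m =>
                (∃ k, a (i, τ i) = MvPolynomial.X k) ∧ g (Sum.inl i) < h).card ∧
              3 * (Finset.univ.filter fun i : Fin m =>
                (∃ k, a (i, τ i) = MvPolynomial.X k) ∧ g (Sum.inl i) < h).card ≤ 2 * n) ∧
          (∀ τ : Equiv.Perm (Fin m), (∀ i, (i, τ i) ∈ E ∧ a (i, τ i) ≠ 0) →
            (Finset.univ.filter fun i : Fin m =>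
              (∃ k, a (i, τ i) = MvPolynomial.X k) ∧ g (Sum.inl i) = h).card = ch) ∧
          (∀ τ : Equiv.Perm (Fin m), (∀ i, (i, τ i) ∈ E ∧ a (i, τ i) ≠ 0) →
            (Finset.univ.filter fun i : Fin m =>
              (∃ k, a (i, τ i) = MvPolynomial.X k) ∧ g (Sum.inl i) = h - 1).card = cq) ∧
          ch + cq ≤ (Nat.log 2 m + d) ^ d) :
    ∃ d n₀ : ℕ, ∀ (n m : ℕ) (E : Finset (Fin m × Fin m))
      (a : Fin m × Fin m → MvPolynomial (Fin n × Fin n) ℂ), n₀ ≤ n →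
      (∃ s : Fin m × Fin m → ℂ, (∀ e, s e = 1 ∨ s e = -1) ∧
        (Matrix.of fun i j => if (i, j) ∈ E then MvPolynomial.C (s (i, j)) * MvPolynomial.X (i, j)
            else 0 : Matrix (Fin m) (Fin m) (MvPolynomial (Fin m × Fin m) ℂ)).det =
          (Matrix.of fun i j => if (i, j) ∈ E then MvPolynomial.X (i, j) else 0 :
            Matrix (Fin m) (Fin m) (MvPolynomial (Fin m × Fin m) ℂ)).permanent) →
      (∀ e, (∃ j, a e = MvPolynomial.X j) ∨ a e = 0 ∨ a e = 1) →
      perPoly (Fin n) ℂ =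
        MvPolynomial.aeval a (Matrix.of fun i j => if (i, j) ∈ E then MvPolynomial.X (i, j) else 0 :
            Matrix (Fin m) (Fin m) (MvPolynomial (Fin m × Fin m) ℂ)).permanent →
      ∀ g : Fin m ⊕ Fin m → ℕ,
        (∀ τ : Equiv.Perm (Fin m), (∀ i, (i, τ i) ∈ E ∧ a (i, τ i) ≠ 0) → ∀ i,
          (∃ k, a (i, τ i) = MvPolynomial.X k) → g (Sum.inr (τ i)) = g (Sum.inl i) + 1) →
        (∀ τ : Equiv.Perm (Fin m), (∀ i, (i, τ i) ∈ E ∧ a (i, τ i) ≠ 0) → ∀ i,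
          (¬ ∃ k, a (i, τ i) = MvPolynomial.X k) → g (Sum.inr (τ i)) = g (Sum.inl i)) →
        ∃ h ch cq : ℕ, 1 ≤ h ∧
          (∀ τ : Equiv.Perm (Fin m), (∀ i, (i, τ i) ∈ E ∧ a (i, τ i) ≠ 0) →
            n ≤ 3 * (Finset.univ.filter fun i : Fin m =>
                (∃ k, a (i, τ i) = MvPolynomial.X k) ∧ g (Sum.inl i) < h).card ∧
              3 * (Finset.univ.filter fun i : Fin m =>
                (∃ k, a (i, τ i) = MvPolynomial.X k) ∧ g (Sum.inl i) < h).card ≤ 2 * n) ∧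
          (∀ τ : Equiv.Perm (Fin m), (∀ i, (i, τ i) ∈ E ∧ a (i, τ i) ≠ 0) →
            (Finset.univ.filter fun i : Fin m =>
              (∃ k, a (i, τ i) = MvPolynomial.X k) ∧ g (Sum.inl i) = h).card = ch) ∧
          (∀ τ : Equiv.Perm (Fin m), (∀ i, (i, τ i) ∈ E ∧ a (i, τ i) ≠ 0) →
            (Finset.univ.filter fun i : Fin m =>
              (∃ k, a (i, τ i) = MvPolynomial.X k) ∧ g (Sum.inl i) = h - 1).card = cq) ∧
          ch + cq ≤ (Nat.log 2 m + d) ^ d := by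
  obtain ⟨d, n₀, hd⟩ := hmix
  refine ⟨d + 2, n₀ + 7, ?_⟩
  intro n m E a hn hsig ha hper g hg1 hg0
  by_cases hmx : ∃ τ τ' : Equiv.Perm (Fin m), (∀ i, (i, τ i) ∈ E ∧ a (i, τ i) ≠ 0) ∧
      (∀ i, (i, τ' i) ∈ E ∧ a (i, τ' i) ≠ 0) ∧ ∃ (i i' : Fin m) (v : Fin n × Fin n),
        a (i, τ i) = MvPolynomial.X v ∧ a (i', τ' i') = MvPolynomial.X v ∧
        g (Sum.inl i) ≠ g (Sum.inl i')
  · -- a level-mixing cover: the hypothesis applies (with a weaker exponent)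
    obtain ⟨h, ch, cq, h1, hbal, hch, hcq, hle⟩ := hd n m E a (by omega) hsig ha hper g hg1 hg0 hmx
    refine ⟨h, ch, cq, h1, hbal, hch, hcq, hle.trans ?_⟩
    calc (Nat.log 2 m + d) ^ d ≤ (Nat.log 2 m + (d + 2)) ^ d := Nat.pow_le_pow_left (by omega) d
      _ ≤ (Nat.log 2 m + (d + 2)) ^ (d + 2) := Nat.pow_le_pow_right (by omega) (by omega)
  -- otherwise the cover is label-levelled on its used edges
  push Not at hmx
  have hg : ∀ τ : Equiv.Perm (Fin m), (∀ i, (i, τ i) ∈ E ∧ a (i, τ i) ≠ 0) → ∀ i,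
      ((∃ k, a (i, τ i) = MvPolynomial.X k) → g (Sum.inr (τ i)) = g (Sum.inl i) + 1) ∧
      ((¬ ∃ k, a (i, τ i) = MvPolynomial.X k) → g (Sum.inr (τ i)) = g (Sum.inl i)) :=
    fun τ hτ i => ⟨hg1 τ hτ i, hg0 τ hτ i⟩
  -- the used-edge sub-cover: every nonzero edge used, so the level hypotheses hold edge-wise
  set Eu := E.filter (fun e => a e ≠ 0 ∧ ∃ σ : Equiv.Perm (Fin m),
    (∀ k, (k, σ k) ∈ E ∧ a (k, σ k) ≠ 0) ∧ σ e.1 = e.2) with hEu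
  have hperu := perIdentity_usedEdges E a ha hper
  have hgood : ∀ τ : Equiv.Perm (Fin m), (∀ i, (i, τ i) ∈ Eu ∧ a (i, τ i) ≠ 0) ↔
      (∀ i, (i, τ i) ∈ E ∧ a (i, τ i) ≠ 0) := good_usedEdges_iff E a
  have hvaru : ∀ i j, (i, j) ∈ Eu → (∃ k, a (i, j) = MvPolynomial.X k) →
      g (Sum.inr j) = g (Sum.inl i) + 1 := by
    intro i j hij hv
    obtain ⟨σ, hσ, hσi⟩ := used_usedEdges E a i j hij
    subst hσi
    exact hg1 σ ((hgood σ).1 hσ) i hv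
  have honeu : ∀ i j, (i, j) ∈ Eu → a (i, j) ≠ 0 → (¬ ∃ k, a (i, j) = MvPolynomial.X k) →
      g (Sum.inr j) = g (Sum.inl i) := by
    intro i j hij _ hv
    obtain ⟨σ, hσ, hσi⟩ := used_usedEdges E a i j hij
    subst hσi
    exact hg0 σ ((hgood σ).1 hσ) i hv
  -- the label-levelling
  have hLex : ∃ L : Fin n × Fin n → ℕ, ∀ i j, (i, j) ∈ Eu → ∀ v : Fin n × Fin n,
      a (i, j) = MvPolynomial.X v → g (Sum.inl i) = L v := by
    refine ⟨fun v => if hx : ∃ p : Fin m × Fin m, p ∈ Eu ∧ a p = MvPolynomial.X v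
      then g (Sum.inl hx.choose.1) else 0, ?_⟩
    intro i j hij v hv
    have hex : ∃ p : Fin m × Fin m, p ∈ Eu ∧ a p = MvPolynomial.X v := ⟨(i, j), hij, hv⟩
    show g (Sum.inl i) = (if hx : ∃ p : Fin m × Fin m, p ∈ Eu ∧ a p = MvPolynomial.X v
      then g (Sum.inl hx.choose.1) else 0)
    rw [dif_pos hex]
    obtain ⟨hmem, hv'⟩ := hex.choose_spec
    obtain ⟨σ, hσ, hσi⟩ := used_usedEdges E a i j hij
    obtain ⟨σ', hσ', hσ'i⟩ := used_usedEdges E a hex.choose.1 hex.choose.2 hmem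
    refine hmx σ σ' ((hgood σ).1 hσ) ((hgood σ').1 hσ') i hex.choose.1 v ?_ ?_
    · rw [hσi]; exact hv
    · rw [hσ'i]; exact hv'
  obtain ⟨L, hL⟩ := hLex
  -- all widths are `≤ 2`
  have hwidth : ∀ τ : Equiv.Perm (Fin m), (∀ i, (i, τ i) ∈ E ∧ a (i, τ i) ≠ 0) → ∀ ℓ,
      (univ.filter fun i : Fin m =>
        (∃ k, a (i, τ i) = MvPolynomial.X k) ∧ g (Sum.inl i) = ℓ).card ≤ 2 := by
    rcases rowLevelled_or_colLevelled_of_labelLevelled Eu a ha hperu g hvaru honeu L hL with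
      ⟨L₁, hL₁⟩ | ⟨L₂, hL₂⟩
    · intro τ hτ ℓ
      exact width_le_two_of_rowLevelled n m E a hsig ha hper g hg L₁
        (fun τ hτ i v hv => hL₁ i (τ i) ((hgood τ).2 hτ i).1 v hv) τ hτ ℓ
    · intro τ hτ ℓ
      exact width_le_two_of_colLevelled n m E a hsig ha hper g hg L₂
        (fun τ hτ i v hv => hL₂ i (τ i) ((hgood τ).2 hτ i).1 v hv) τ hτ ℓ
  -- a balanced level for one matching, transferred to all
  obtain ⟨τ₀, hτ₀, -⟩ := exists_good_of_perm E a ha hper 1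
  have htot := card_var_eq E a ha hper τ₀ hτ₀
  obtain ⟨h, h1, hlo, hhi⟩ := exists_balanced_level a g τ₀ (by omega) htot
    (fun ℓ => by have := hwidth τ₀ hτ₀ ℓ; omega)
  refine ⟨h, (univ.filter fun i : Fin m =>
      (∃ k, a (i, τ₀ i) = MvPolynomial.X k) ∧ g (Sum.inl i) = h).card,
    (univ.filter fun i : Fin m =>
      (∃ k, a (i, τ₀ i) = MvPolynomial.X k) ∧ g (Sum.inl i) = h - 1).card, h1, ?_, ?_, ?_, ?_⟩
  · intro τ hτ
    rw [belowCount_eq Eu a g hvaru honeu τ τ₀ ((hgood τ).2 hτ) ((hgood τ₀).2 hτ₀) h]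
    exact ⟨hlo, hhi⟩
  · intro τ hτ
    exact varCount_eq Eu a g hvaru honeu τ τ₀ ((hgood τ).2 hτ) ((hgood τ₀).2 hτ₀) h
  · intro τ hτ
    exact varCount_eq Eu a g hvaru honeu τ τ₀ ((hgood τ).2 hτ) ((hgood τ₀).2 hτ₀) (h - 1)
  · have hw1 := hwidth τ₀ hτ₀ h
    have hw2 := hwidth τ₀ hτ₀ (h - 1)
    have h2 : 2 ≤ Nat.log 2 m + (d + 2) := by omega
    calc (univ.filter fun i : Fin m =>
            (∃ k, a (i, τ₀ i) = MvPolynomial.X k) ∧ g (Sum.inl i) = h).card +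
          (univ.filter fun i : Fin m =>
            (∃ k, a (i, τ₀ i) = MvPolynomial.X k) ∧ g (Sum.inl i) = h - 1).card
        ≤ 2 ^ 2 := by omega
      _ ≤ (Nat.log 2 m + (d + 2)) ^ 2 := Nat.pow_le_pow_left h2 2
      _ ≤ (Nat.log 2 m + (d + 2)) ^ (d + 2) := Nat.pow_le_pow_right (by omega) (by omega)

/-- **The crux is reduced to level-mixing covers**: the width bet for level-mixing label-bijective
Pfaffian covers implies `MonotoneCoverHard` (by name). -/
theorem monotoneCoverHard_of_mixingWidthBet
    (hmix : ∃ d n₀ : ℕ, ∀ (n m : ℕ) (E : Finset (Fin m × Fin m))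
      (a : Fin m × Fin m → MvPolynomial (Fin n × Fin n) ℂ), n₀ ≤ n →
      (∃ s : Fin m × Fin m → ℂ, (∀ e, s e = 1 ∨ s e = -1) ∧
        (Matrix.of fun i j => if (i, j) ∈ E then MvPolynomial.C (s (i, j)) * MvPolynomial.X (i, j)
            else 0 : Matrix (Fin m) (Fin m) (MvPolynomial (Fin m × Fin m) ℂ)).det =
          (Matrix.of fun i j => if (i, j) ∈ E then MvPolynomial.X (i, j) else 0 :
            Matrix (Fin m) (Fin m) (MvPolynomial (Fin m × Fin m) ℂ)).permanent) →
      (∀ e, (∃ j, a e = MvPolynomial.X j) ∨ a e = 0 ∨ a e = 1) →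
      perPoly (Fin n) ℂ =
        MvPolynomial.aeval a (Matrix.of fun i j => if (i, j) ∈ E then MvPolynomial.X (i, j) else 0 :
            Matrix (Fin m) (Fin m) (MvPolynomial (Fin m × Fin m) ℂ)).permanent →
      ∀ g : Fin m ⊕ Fin m → ℕ,
        (∀ τ : Equiv.Perm (Fin m), (∀ i, (i, τ i) ∈ E ∧ a (i, τ i) ≠ 0) → ∀ i,
          (∃ k, a (i, τ i) = MvPolynomial.X k) → g (Sum.inr (τ i)) = g (Sum.inl i) + 1) →
        (∀ τ : Equiv.Perm (Fin m), (∀ i, (i, τ i) ∈ E ∧ a (i, τ i) ≠ 0) → ∀ i,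
          (¬ ∃ k, a (i, τ i) = MvPolynomial.X k) → g (Sum.inr (τ i)) = g (Sum.inl i)) →
        (∃ τ τ' : Equiv.Perm (Fin m), (∀ i, (i, τ i) ∈ E ∧ a (i, τ i) ≠ 0) ∧
          (∀ i, (i, τ' i) ∈ E ∧ a (i, τ' i) ≠ 0) ∧ ∃ (i i' : Fin m) (v : Fin n × Fin n),
            a (i, τ i) = MvPolynomial.X v ∧ a (i', τ' i') = MvPolynomial.X v ∧
            g (Sum.inl i) ≠ g (Sum.inl i')) →
        ∃ h ch cq : ℕ, 1 ≤ h ∧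
          (∀ τ : Equiv.Perm (Fin m), (∀ i, (i, τ i) ∈ E ∧ a (i, τ i) ≠ 0) →
            n ≤ 3 * (Finset.univ.filter fun i : Fin m =>
                (∃ k, a (i, τ i) = MvPolynomial.X k) ∧ g (Sum.inl i) < h).card ∧
              3 * (Finset.univ.filter fun i : Fin m =>
                (∃ k, a (i, τ i) = MvPolynomial.X k) ∧ g (Sum.inl i) < h).card ≤ 2 * n) ∧
          (∀ τ : Equiv.Perm (Fin m), (∀ i, (i, τ i) ∈ E ∧ a (i, τ i) ≠ 0) →
            (Finset.univ.filter fun i : Fin m =>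
              (∃ k, a (i, τ i) = MvPolynomial.X k) ∧ g (Sum.inl i) = h).card = ch) ∧
          (∀ τ : Equiv.Perm (Fin m), (∀ i, (i, τ i) ∈ E ∧ a (i, τ i) ≠ 0) →
            (Finset.univ.filter fun i : Fin m =>
              (∃ k, a (i, τ i) = MvPolynomial.X k) ∧ g (Sum.inl i) = h - 1).card = cq) ∧
          ch + cq ≤ (Nat.log 2 m + d) ^ d) :
    MonotoneCoverHard :=
  monotoneCoverHard_of_widthBet (widthBet_of_mixingWidthBet hmix)

end Summit.ValiantsHypothesis.ValiantsHypothesis.Theorems.PolyaContinuedMonotoneCoverHard
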